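import Literature.Probability.Percolation.TrapPairSetting
import HarnessLib

/-!
# The pair step: final crossings, minimal terms, canonical routes, the reach set

Topic `Literature/Probability/Percolation`; family `crit-perc` / near-critical percolation on `𝕋`.
A brick of the near-critical arm-separation theorem for four arms in the ADJACENT colour
arrangement (P. Nolin, EJP 13 (2008), Thm. 11, `j = 4`, `σ = BBWW` [arXiv 0711.4948: Thm. 10];
the last missing input `hsepAdj` of `Werner2009_lemma63_of_altSeparation_of_adjSeparation`).

In the setting `PairData` (`TrapPairSetting.lean`) of the rerouting of two arms of the same
colour (Nolin 2008, §4.4, proof of Lemma 15, last paragraph), Menger's theorem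
(`exists_two_disjoint_paths`) asks for one admissible route from a start `a i` to a fence site
`m_u`, and for one such route avoiding any given admissible site `zz`. This file provides:

* `αF i`, `αF_isCrossing` — the final trapezoid crossing of the arm `i` (a crossing of
  `trapDomain M`, `exists_final_crossing_walk`); `uMin i` — the least index of a term it meets
  (`exists_lowestSeq_inter_nonempty`), `uMin_ne` — the two indices differ (`pair_min_terms`);
* `exists_route` — the canonical route of the arm `i` to the fence of its minimal term, avoiding
  any site off the arms and off that term's structure; `hone` (some admissible route exists);
* `Reach zz` — the admissible sites joined to a start avoiding `zz`, `IsCut zz` — no fence site is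
  reached; closure lemmas (`reach_of_pathIn`, `mem_reach_of_prefix`, `arm_subset_reach`,
  `term_subset_reach`, `fence_not_reach`, `q_not_reach`);
* `not_isCut_of_not_mem_armSet` — a site off the arms is never a cut (it damages the structure of
  at most one term, `term_eq_of_mem_struct`, and the minimal terms of the two arms differ).

Everything here is proved; no named facts are introduced.

## References

* P. Nolin, Near-critical percolation in two dimensions, *Electron. J. Probab.* 13 (2008), §4.4,
  proof of Lemma 15 (arXiv 0711.4948: Lemma 14), last paragraph [Nolin2008].
* R. Diestel, *Graph Theory*, 5th ed. (2017), Thm. 3.3.1 (Menger) [Diestel2017].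

Tree: `PairData` (`TrapPairSetting.lean`), `exists_final_crossing_walk` (`TrapFinalCrossing.lean`),
`JDomain.exists_lowestSeq_inter_nonempty`, `JDomain.pair_min_terms`, `eq_of_mem_trapO`,
`PathIn.of_walk_mem_support`, `PathIn.of_adj`.
-/

noncomputable section

open Set

namespace Literature.Probability.Percolation

open LatticeModels

namespace PairData

variable {M n k₀ K T : ℕ} {ω : SiteConfig (Site 2)}

/-! ### Final crossings and minimal terms -/

/-- Bookkeeping (`exists_αF`). [folklore] -/
theorem exists_αF (D : PairData M n k₀ K T ω) (i : Fin 2) :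
    ∃ a : Finset (Site 2), (trapDomain M).IsCrossing a (D.y i) ∧ (∀ v ∈ a, v ∈ (D.A i).support) :=
  by
  classical
  obtain ⟨q, β, γ, -, -, -, -, hsub, hcr⟩ := exists_final_crossing_walk (D.A i) (D.isPath i)
    (fun v hv => (D.supp i v hv).1) (D.a0_le i) (D.y_mem i) (D.clean i)
  exact ⟨γ.support.toFinset, hcr, fun v hv => hsub v (List.mem_toFinset.1 hv)⟩

/-- **The final crossing of the arm `i`** (as a set of sites). [cite: Nolin2008, §4.4 (arXiv 0711.4948: proof of Lemma 14)] -/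
def αF (D : PairData M n k₀ K T ω) (i : Fin 2) : Finset (Site 2) := Classical.choose (D.exists_αF i)

/-- Bookkeeping (`αF_isCrossing`). [folklore] -/
theorem αF_isCrossing (D : PairData M n k₀ K T ω) (i : Fin 2) : (trapDomain M).IsCrossing (D.αF i) (D.y i) :=
  (Classical.choose_spec (D.exists_αF i)).1

/-- Bookkeeping (`αF_subset`). [folklore] -/
theorem αF_subset (D : PairData M n k₀ K T ω) (i : Fin 2) : ∀ v ∈ D.αF i, v ∈ (D.A i).support :=
  (Classical.choose_spec (D.exists_αF i)).2

/-- Bookkeeping (`αF_open`). [folklore] -/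
theorem αF_open (D : PairData M n k₀ K T ω) (i : Fin 2) : (↑(D.αF i) : Set (Site 2)) ⊆ ω :=
  fun v hv => D.mem_omega (D.αF_subset i v (Finset.mem_coe.1 hv))

/-- Bookkeeping (`αF_disjoint`). [folklore] -/
theorem αF_disjoint (D : PairData M n k₀ K T ω) {i j : Fin 2} (hij : i ≠ j) : Disjoint (D.αF i) (D.αF j) :=
  Finset.disjoint_left.2 fun v hv hv' => D.disj' hij (D.αF_subset i v hv) (D.αF_subset j v hv')

/-- Bookkeeping (`exists_meet`). [folklore] -/
theorem exists_meet (D : PairData M n k₀ K T ω) (i : Fin 2) :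
    ∃ u, ∃ c z, (trapDomain M).lowestSeq ω u = some (c, z) ∧ (D.αF i ∩ c).Nonempty := by
  obtain ⟨u, c, z, hu, hne⟩ := JDomain.exists_lowestSeq_inter_nonempty (trapDomain_cutProp M) (D.αF_isCrossing i) (D.αF_open i)
  exact ⟨u, c, z, hu, hne⟩

open Classical in
/-- **The minimal term of the arm `i`**: the least index of a term met by its final crossing. [cite: Nolin2008, §4.4 (arXiv 0711.4948: proof of Lemma 14)] -/
def uMin (D : PairData M n k₀ K T ω) (i : Fin 2) : ℕ := Nat.find (D.exists_meet i)

open Classical in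
/-- Bookkeeping (`uMin_spec`). [folklore] -/
theorem uMin_spec (D : PairData M n k₀ K T ω) (i : Fin 2) :
    ∃ c z, (trapDomain M).lowestSeq ω (D.uMin i) = some (c, z) ∧ (D.αF i ∩ c).Nonempty :=
  Nat.find_spec (D.exists_meet i)

open Classical in
/-- Bookkeeping (`uMin_min`). [folklore] -/
theorem uMin_min (D : PairData M n k₀ K T ω) (i : Fin 2) :
    ∀ v < D.uMin i, ∀ c z, (trapDomain M).lowestSeq ω v = some (c, z) → Disjoint (D.αF i) c := by
  intro v hv c z h
  have := Nat.find_min (D.exists_meet i) hv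
  push Not at this
  exact Finset.disjoint_iff_inter_eq_empty.2 (this c z h)

/-- The final crossing of the arm `i` lies above every term before its minimal one. [cite: KestenPTM1982, §2.3 Prop. 2.3] -/
theorem αF_stage (D : PairData M n k₀ K T ω) (i : Fin 2) :
    ∀ v c z, v + 1 = D.uMin i → (trapDomain M).lowestSeq ω v = some (c, z) → D.αF i ⊆ (trapDomain M).above c z :=
  fun v c z hv h => JDomain.subset_above_of_forall_disjoint (D.αF_isCrossing i) (D.αF_open i) v
    (fun v' hv' c' z' h' => D.uMin_min i v' (by omega) c' z' h') c z h

/-- The minimal term meets the final crossing. [folklore] -/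
theorem αF_meet (D : PairData M n k₀ K T ω) (i : Fin 2) {c : Finset (Site 2)} {z : Site 2}
    (hu : (trapDomain M).lowestSeq ω (D.uMin i) = some (c, z)) : (D.αF i ∩ c).Nonempty := by
  obtain ⟨c', z', hu', hne⟩ := D.uMin_spec i
  obtain ⟨rfl, rfl⟩ := term_eq hu' hu
  exact hne

/-- **The minimal terms of the two arms differ** (`pair_min_terms`: the lower final crossing has
the strictly smaller minimal term). [cite: Nolin2008, §4.4 (arXiv 0711.4948: proof of Lemma 14, "v₂ > v₁")] -/
theorem uMin_lt_of_lt (D : PairData M n k₀ K T ω) {i j : Fin 2} (hij : i ≠ j) (hlt : (D.y i) 1 < (D.y j) 1) :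
    D.uMin i < D.uMin j := by
  obtain ⟨c₁, z₁, hu₁, -⟩ := D.uMin_spec i
  obtain ⟨c₂, z₂, hu₂, hmeet₂⟩ := D.uMin_spec j
  exact (JDomain.pair_min_terms (trapDomain_cutProp M) D.hdual (D.αF_isCrossing i) (D.αF_open i)
    (D.αF_isCrossing j) (D.αF_open j) (D.αF_disjoint hij) (by simpa using hlt) hu₁ (D.uMin_min i) hu₂ hmeet₂
    (D.uMin_min j)).2.2.2.2.2.2

/-- Bookkeeping (`y_ne`). [folklore] -/
theorem y_ne (D : PairData M n k₀ K T ω) {i j : Fin 2} (hij : i ≠ j) : D.y i ≠ D.y j := fun h =>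
  D.disj' hij (D.A i).end_mem_support (by rw [h]; exact (D.A j).end_mem_support)

/-- Bookkeeping (`uMin_ne`). [folklore] -/
theorem uMin_ne (D : PairData M n k₀ K T ω) {i j : Fin 2} (hij : i ≠ j) : D.uMin i ≠ D.uMin j := by
  rcases lt_trichotomy ((D.y i) 1) ((D.y j) 1) with h | h | h
  · exact (D.uMin_lt_of_lt hij h).ne
  · exact absurd (eq_of_mem_trapO (D.y_mem i) (D.y_mem j) h) (D.y_ne hij)
  · exact (D.uMin_lt_of_lt hij.symm h).ne'

/-! ### Canonical routes -/

/-- A prefix of an arm avoiding `zz` is an admissible path avoiding `zz`. [folklore] -/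
theorem pathIn_prefix (D : PairData M n k₀ K T ω) (i : Fin 2) {x : Site 2} (hx : x ∈ (D.A i).support) {zz : Site 2}
    (hzz : zz ∉ ((D.A i).takeUntil x hx).support) : PathIn triGraph (D.Aset \ {zz}) (D.a i) x := by
  classical
  have hsub : ∀ v ∈ ((D.A i).takeUntil x hx).support, v ∈ D.Aset \ {zz} := fun v hv =>
    ⟨D.armSet_subset_Aset (D.mem_armSet ((D.A i).support_takeUntil_subset_support hx hv)), fun h => hzz (h ▸ hv)⟩
  exact (PathIn.of_walk_mem_support ((D.A i).takeUntil x hx) hsub ((D.A i).takeUntil x hx).end_mem_support).1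

/-- **The fence is reached from its attachment site**: `q → p → … → m` avoiding any `zz` off the
connection and different from `q`. [folklore] -/
theorem pathIn_q_m (D : PairData M n k₀ K T ω) {u : ℕ} {c : Finset (Site 2)} {z : Site 2}
    (hu : (trapDomain M).lowestSeq ω u = some (c, z)) {zz : Site 2} (hzF : zz ∉ (D.fence hu).F)
    (hzq : zz ≠ (D.fence hu).q) (hqA : (D.fence hu).q ∈ D.Aset) :
    PathIn triGraph (D.Aset \ {zz}) (D.fence hu).q (D.fence hu).m := by
  set Tf := D.fence hu
  have hF : Tf.F ⊆ D.Aset \ {zz} := fun v hv => ⟨D.fence_subset_Aset hu hv, fun h => hzF (h ▸ hv)⟩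
  have hq' : Tf.q ∈ D.Aset \ {zz} := ⟨hqA, fun h => hzq (Set.mem_singleton_iff.1 h).symm⟩
  exact (PathIn.of_adj hq' (hF Tf.p_mem) Tf.adj).trans (Tf.path.mono hF)

/-- The attachment site of a fence is admissible. [folklore] -/
theorem q_mem_Aset (D : PairData M n k₀ K T ω) {u : ℕ} {c : Finset (Site 2)} {z : Site 2}
    (hu : (trapDomain M).lowestSeq ω u = some (c, z)) : (D.fence hu).q ∈ D.Aset := by
  rcases (D.fence hu).q_mem with h | h
  · exact D.term_subset_Aset hu h
  · exact D.armSet_subset_Aset h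

/-- **The canonical route of the arm `i`, avoiding `zz`.** If `zz` is off the arms, off the minimal
term `c` of the arm `i` and off the connection of its fence, some start is joined to the fence
site `m` of `c` by an admissible path avoiding `zz`: along an arm to the attachment site when the
fence is attached to an arm, else along the arm `i` to its final crossing's site on `c`, inside
`c` to the attachment site, then through the connection. [cite: Nolin2008, §4.4 Lemma 15 (proof) (arXiv 0711.4948: Lemma 14)] -/
theorem exists_route (D : PairData M n k₀ K T ω) (i : Fin 2) {c : Finset (Site 2)} {z : Site 2}
    (hu : (trapDomain M).lowestSeq ω (D.uMin i) = some (c, z)) {zz : Site 2} (hzarm : zz ∉ D.armSet)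
    (hzc : zz ∉ c) (hzF : zz ∉ (D.fence hu).F) : ∃ i', PathIn triGraph (D.Aset \ {zz}) (D.a i') (D.fence hu).m := by
  classical
  set Tf := D.fence hu
  have hqA := D.q_mem_Aset hu
  rcases Tf.q_mem with hq | ⟨i', hq⟩
  · -- attached to the term: arm `i` to its site `x` on `c`, then inside `c`
    have hzq : zz ≠ Tf.q := fun h => hzc (h ▸ Finset.mem_coe.1 hq)
    obtain ⟨x, hx⟩ := D.αF_meet i hu
    rw [Finset.mem_inter] at hx
    have hxA : x ∈ (D.A i).support := D.αF_subset i x hx.1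
    have h1 : PathIn triGraph (D.Aset \ {zz}) (D.a i) x :=
      D.pathIn_prefix i hxA fun h => hzarm (D.mem_armSet ((D.A i).support_takeUntil_subset_support hxA h))
    have h2 : PathIn triGraph (D.Aset \ {zz}) x Tf.q :=
      ((term_isCrossing hu).conn x hx.2 Tf.q (Finset.mem_coe.1 hq)).mono fun v hv =>
        ⟨D.term_subset_Aset hu hv, fun h => hzc (h ▸ Finset.mem_coe.1 hv)⟩
    exact ⟨i, (h1.trans h2).trans (D.pathIn_q_m hu hzF hzq hqA)⟩
  · -- attached to the arm `i'`
    have hzq : zz ≠ Tf.q := fun h => hzarm (h ▸ ⟨i', hq⟩)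
    have h1 : PathIn triGraph (D.Aset \ {zz}) (D.a i') Tf.q :=
      D.pathIn_prefix i' hq fun h => hzarm (D.mem_armSet ((D.A i').support_takeUntil_subset_support hq h))
    exact ⟨i', h1.trans (D.pathIn_q_m hu hzF hzq hqA)⟩

/-- The origin is not admissible (arm sites have norm `≥ n ≥ 1`, term and fence sites have
`v₀ > M ≥ 1` or norm `> 2M`). [folklore] -/
theorem zero_not_mem_Aset (D : PairData M n k₀ K T ω) : (0 : Site 2) ∉ D.Aset := by
  have h0 : triNorm (0 : Site 2) = 0 := by simp [triNorm]
  have hn : (1 : ℤ) ≤ n := by exact_mod_cast D.hn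
  rintro (⟨i, hv⟩ | ⟨u, c, z, hu, hv | hv⟩)
  · have := D.norm_ge hv; omega
  · have h1 := (mem_trapD.1 ((term_isCrossing hu).subset (Finset.mem_coe.1 hv))).1
    simp at h1
    omega
  · by_cases hnn : triNorm (0 : Site 2) ≤ 2 * M
    · have h1 := (mem_trapD.1 (mem_fenceSet_inside ((D.fence hu).F_subset hv) hnn).1).1
      simp at h1
      omega
    · rw [h0] at hnn; omega

/-- **Some admissible route exists** (Menger's first hypothesis). [folklore] -/
theorem hone (D : PairData M n k₀ K T ω) :
    ∃ (s t : Site 2) (q : triGraph.Walk s t), s ∈ ({D.a 0, D.a 1} : Set (Site 2)) ∧ t ∈ D.Tset ∧ ∀ v ∈ q.support, v ∈ D.Aset := by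
  obtain ⟨c, z, hu, -⟩ := D.uMin_spec 0
  have h0 := D.zero_not_mem_Aset
  obtain ⟨i', hp⟩ := D.exists_route 0 hu (fun h => h0 (D.armSet_subset_Aset h)) (fun h => h0 (D.term_subset_Aset hu h))
    (fun h => h0 (D.fence_subset_Aset hu h))
  obtain ⟨w, hw⟩ := hp.exists_walk
  refine ⟨D.a i', (D.fence hu).m, w, ?_, D.m_mem_Tset hu, fun v hv => (hw v hv).1⟩
  fin_cases i' <;> simp

/-! ### The reach set of a candidate cut -/

/-- **The reach set avoiding `zz`**: admissible sites joined to a start by an admissible path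
avoiding `zz`. [folklore] -/
def Reach (D : PairData M n k₀ K T ω) (zz : Site 2) : Set (Site 2) := {x | ∃ i, PathIn triGraph (D.Aset \ {zz}) (D.a i) x}

/-- **`zz` is a cut**: an admissible site such that no fence site is reached avoiding it. [folklore] -/
def IsCut (D : PairData M n k₀ K T ω) (zz : Site 2) : Prop :=
  zz ∈ D.Aset ∧ ∀ (u : ℕ) (c : Finset (Site 2)) (z : Site 2) (hu : (trapDomain M).lowestSeq ω u = some (c, z)),
    (D.fence hu).m ∉ D.Reach zz

/-- Bookkeeping (`reach_subset`). [folklore] -/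
theorem reach_subset (D : PairData M n k₀ K T ω) {zz x : Site 2} (hx : x ∈ D.Reach zz) : x ∈ D.Aset ∧ x ≠ zz := by
  obtain ⟨i, hp⟩ := hx; exact ⟨hp.right_mem.1, hp.right_mem.2⟩

/-- Bookkeeping (`reach_of_pathIn`). [folklore] -/
theorem reach_of_pathIn (D : PairData M n k₀ K T ω) {zz x y : Site 2} (hx : x ∈ D.Reach zz)
    (hp : PathIn triGraph (D.Aset \ {zz}) x y) : y ∈ D.Reach zz := by
  obtain ⟨i, hpx⟩ := hx; exact ⟨i, hpx.trans hp⟩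

/-- Bookkeeping (`reach_of_adj`). [folklore] -/
theorem reach_of_adj (D : PairData M n k₀ K T ω) {zz x y : Site 2} (hx : x ∈ D.Reach zz) (hy : y ∈ D.Aset) (hyz : y ≠ zz)
    (hadj : triGraph.Adj x y) : y ∈ D.Reach zz :=
  D.reach_of_pathIn hx (PathIn.of_adj (D.reach_subset hx |> fun h => ⟨h.1, h.2⟩) ⟨hy, hyz⟩ hadj)

/-- A vertex of an arm whose prefix avoids `zz` is reached. [folklore] -/
theorem mem_reach_of_prefix (D : PairData M n k₀ K T ω) (i : Fin 2) {x : Site 2} (hx : x ∈ (D.A i).support) {zz : Site 2}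
    (hzz : zz ∉ ((D.A i).takeUntil x hx).support) : x ∈ D.Reach zz := ⟨i, D.pathIn_prefix i hx hzz⟩

/-- An arm avoiding `zz` is reached entirely. [folklore] -/
theorem arm_subset_reach (D : PairData M n k₀ K T ω) (j : Fin 2) {zz : Site 2} (hzz : zz ∉ (D.A j).support) :
    ∀ x ∈ (D.A j).support, x ∈ D.Reach zz := fun _ hx =>
  D.mem_reach_of_prefix j hx fun h => hzz ((D.A j).support_takeUntil_subset_support hx h)

/-- A term off `zz` with a reached site is reached entirely. [folklore] -/
theorem term_subset_reach (D : PairData M n k₀ K T ω) {u : ℕ} {c : Finset (Site 2)} {z : Site 2}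
    (hu : (trapDomain M).lowestSeq ω u = some (c, z)) {zz : Site 2} (hzc : zz ∉ c) {x : Site 2} (hx : x ∈ c)
    (hxr : x ∈ D.Reach zz) : ∀ x' ∈ c, x' ∈ D.Reach zz := fun x' hx' =>
  D.reach_of_pathIn hxr (((term_isCrossing hu).conn x hx x' hx').mono fun _ hv =>
    ⟨D.term_subset_Aset hu hv, fun h => hzc (h ▸ Finset.mem_coe.1 hv)⟩)

/-- **Under a cut, no site of a fence connection off `zz` is reached.** [folklore] -/
theorem fence_not_reach (D : PairData M n k₀ K T ω) {zz : Site 2} (hcutz : D.IsCut zz) {u : ℕ} {c : Finset (Site 2)} {z : Site 2}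
    (hu : (trapDomain M).lowestSeq ω u = some (c, z)) (hzF : zz ∉ (D.fence hu).F) :
    ∀ x ∈ (D.fence hu).F, x ∉ D.Reach zz := fun _ hx hxr =>
  hcutz.2 u c z hu (D.reach_of_pathIn hxr (((D.fence hu).pathIn_to_m hx).mono fun _ hv =>
    ⟨D.fence_subset_Aset hu hv, fun h => hzF (h ▸ hv)⟩))

/-- **Under a cut, the attachment site of a fence off `zz` is not reached.** [folklore] -/
theorem q_not_reach (D : PairData M n k₀ K T ω) {zz : Site 2} (hcutz : D.IsCut zz) {u : ℕ} {c : Finset (Site 2)} {z : Site 2}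
    (hu : (trapDomain M).lowestSeq ω u = some (c, z)) (hzF : zz ∉ (D.fence hu).F) : (D.fence hu).q ∉ D.Reach zz :=
  fun hq => D.fence_not_reach hcutz hu hzF _ (D.fence hu).p_mem
    (D.reach_of_adj hq (D.fence_subset_Aset hu (D.fence hu).p_mem) (fun h => hzF (h ▸ (D.fence hu).p_mem)) (D.fence hu).adj)

/-! ### A site off the arms is not a cut -/

/-- **A site off the arms is never a cut**: it lies in the structure `c_w ∪ F_w` of at most one
term `w`; the arm whose minimal term is not `w` has its canonical route off `zz`. [cite: Nolin2008, §4.4 Lemma 15 (proof) (arXiv 0711.4948: Lemma 14)] -/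
theorem not_isCut_of_not_mem_armSet (D : PairData M n k₀ K T ω) {zz : Site 2} (hzarm : zz ∉ D.armSet) : ¬ D.IsCut zz := by
  rintro ⟨hzA, hno⟩
  rcases hzA with hz | ⟨w, cw, zw, hw, hzw⟩
  · exact hzarm hz
  -- an arm whose minimal term is not `w`
  obtain ⟨i, hi⟩ : ∃ i : Fin 2, D.uMin i ≠ w := by
    by_cases h : D.uMin 0 = w
    · exact ⟨1, fun h' => D.uMin_ne (show (0 : Fin 2) ≠ 1 by decide) (h.trans h'.symm)⟩
    · exact ⟨0, h⟩
  obtain ⟨c, z, hu, -⟩ := D.uMin_spec i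
  have hzc : zz ∉ c := fun h => hi (D.term_eq_of_mem_struct hu hw (Or.inl (Finset.mem_coe.2 h)) hzw)
  have hzF : zz ∉ (D.fence hu).F := fun h => hi (D.term_eq_of_mem_struct hu hw (Or.inr h) hzw)
  obtain ⟨i', hp⟩ := D.exists_route i hu hzarm hzc hzF
  exact hno _ c z hu ⟨i', hp⟩

end PairData

end Literature.Probability.Percolation
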